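import Summits.QuantumFields.QCD.Theses.SpectralDefectExtinction
import Literature.Barriers.QuantumFields.WilsonDeterminantSign
import Literature.MathematicalPhysics.QuantumLattice.OverlapLocality
import Summits.QuantumFields.QCD.Theorems.ExtinctionBuildsQCD.Negative.ChiralInertia

/-!
# Sketch (crux-ideate r1, ideator 1) — crux `ExtinctionBuildsQCD` (stmt-QuantumFields-18064)

Card `sparse-window-wells` ("Sparse spectrum localises itself"). First lemmas of the line, stated
over existing declarations; they are finite-dimensional linear algebra and need no measure theory.

* (A) `wellBudget_le_windowCount` — MIN-MAX WELL BUDGET: `k` quasi-modes of a Hermitian `H` below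
  level `E`, with pairwise DISJOINT supports and pairwise `H`-orthogonal images, force at least `k`
  eigenvalues of `H` in `(-E, E)`; in the crux's currency the right-hand side is EXTINCT(b)'s
  coercivity-defect count `countP (|z.re| < c·a_k m_f/Z_k) (charpoly (Γ₅ D_W(U, m_f(k), 1))).roots`.
  (Intended proof: the landed Sylvester direction
  `Negative.card_le_card_eigenvalues_of_form_pos` applied to `E² • 1 − Hᴴ * H` and the comparison
  map `c ↦ ∑ a, c a • φ a`, plus the spectral mapping `spec(H²) = spec(H)²`.)
* (B) `agmon_of_outer_floor` — OPERATOR AGMON ESTIMATE with the eigen-equation trick: if `A − λ`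
  is coercive (margin `g`) on vectors supported where `ρ ≥ r₀` (`ρ` a 1-Lipschitz "distance to the
  well set"), then every eigenvector of the range-one matrix `A` with `|λ| ≤ E₀` decays like
  `e^{−κ·(ρ − r₀)}` with `h (e^κ − 1) ≤ g/4` — NO `1/g` PREFACTOR (only commutators `[A, χ w]`
  enter, never `‖A‖/g`). Same toolkit and hypotheses style as the landed
  `CleanReferenceDeterminantLocality.coercive_combes_thomas`.
* (C) `windowModes_localised_on_wells` — the WILSON SPECIALISATION the host line registers as a
  stub: for every `SU(3)` field on the odd four-torus, every bare mass `m₀`, window `w > 0` and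
  `θ ∈ (0, 1/3)`, there is a WELL SET `R` of at most `C(θ, w) · N` sites, `N` = the number of
  eigenvalues of `Γ₅ D_W(U, m₀, 1)` in `(−w, w)`, such that every eigenvector with
  `|λ| ≤ (1 − 2θ) w` carries at most `100 e^{−θ w d/800}` of its mass at taxi distance `≥ d` from `R`.
  With `w = c · a_k m_f / Z_k` this is band screening / repairability / segment localisation of the
  three parked lines in DETERMINISTIC form, with EXTINCT(b)'s count as the only random variable.

PROVED here (sorry-free): the helper identities and `wellBudget_le_card_pos` (A₀) — the budget
mechanism itself, from the landed `Negative.card_le_card_eigenvalues_of_form_pos`; (A) follows from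
(A₀) modulo the standard spectral-mapping step (A₁) `card_pos_shiftSq_eq_countP` (sorry). (B), (C),
(C′) are signatures (`sorry`); (B) is M-sized, (C) is (A)+(B)+IMS patching (L), (C′) is S.
-/

noncomputable section

namespace Summit.QuantumFields.QCD.Cruxes.ExtinctionBuildsQCD.SparseWells

open scoped BigOperators Matrix ComplexConjugate
open Matrix Finset
open Literature.MathematicalPhysics.QuantumLattice Literature.MathematicalPhysics.QuantumFieldTheory
  Literature.Probability.LatticeModels
open Literature.Barriers.QuantumFields.WilsonDeterminant
open Summit.QuantumFields.QCD.Theorems.ExtinctionBuildsQCD.Negative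

local notation "SU3" => Matrix.specialUnitaryGroup (Fin 3) ℂ

section MatrixLemmas

variable {ι : Type*} [Fintype ι] [DecidableEq ι]

omit [DecidableEq ι] in
/-- `Re ⟨u, u⟩ = Σᵢ ‖uᵢ‖²`. [folklore] -/
theorem re_star_dotProduct_self (u : ι → ℂ) : (star u ⬝ᵥ u).re = ∑ i, ‖u i‖ ^ 2 := by
  rw [dotProduct, Complex.re_sum]
  refine Finset.sum_congr rfl fun i _ => ?_
  rw [Pi.star_apply, Complex.star_def, Complex.conj_mul', ← Complex.ofReal_pow, Complex.ofReal_re]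

omit [DecidableEq ι] in
/-- Pythagoras for a finite family of pairwise orthogonal vectors with coefficients. [folklore] -/
theorem star_dotProduct_sum_smul_of_orthogonal {k : ℕ} (u : Fin k → ι → ℂ) (c : Fin k → ℂ)
    (horth : ∀ a b, a ≠ b → star (u a) ⬝ᵥ u b = 0) :
    star (∑ a, c a • u a) ⬝ᵥ (∑ a, c a • u a) = ∑ a, (star (c a) * c a) * (star (u a) ⬝ᵥ u a) := by
  rw [star_sum, sum_dotProduct]
  refine Finset.sum_congr rfl fun a _ => ?_
  rw [star_smul, dotProduct_sum, Finset.sum_eq_single a]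
  · rw [smul_dotProduct, dotProduct_smul, smul_eq_mul, smul_eq_mul]; ring
  · intro b _ hba
    rw [smul_dotProduct, dotProduct_smul, horth a b (Ne.symm hba), smul_zero, smul_zero]
  · intro h; exact absurd (Finset.mem_univ a) h

omit [DecidableEq ι] in
/-- Real part of the Pythagoras identity: `Re ⟨Σ cₐuₐ, Σ cₐuₐ⟩ = Σₐ ‖cₐ‖² ‖uₐ‖²`. [folklore] -/
theorem re_star_dotProduct_sum_smul_of_orthogonal {k : ℕ} (u : Fin k → ι → ℂ) (c : Fin k → ℂ)
    (horth : ∀ a b, a ≠ b → star (u a) ⬝ᵥ u b = 0) :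
    (star (∑ a, c a • u a) ⬝ᵥ (∑ a, c a • u a)).re = ∑ a, ‖c a‖ ^ 2 * ∑ i, ‖u a i‖ ^ 2 := by
  rw [star_dotProduct_sum_smul_of_orthogonal u c horth, Complex.re_sum]
  refine Finset.sum_congr rfl fun a _ => ?_
  rw [Complex.star_def, Complex.conj_mul', ← re_star_dotProduct_self, ← Complex.ofReal_pow,
    Complex.re_ofReal_mul]

/-- **(A₀) Min-max well budget, eigenvalue form (PROVED from the landed Sylvester direction
`Negative.card_le_card_eigenvalues_of_form_pos`).** `k` nonzero vectors with pairwise disjoint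
supports and pairwise orthogonal `H`-images, each a strict quasi-mode of `H` below level `E`,
force `k` positive eigenvalues of `E² − Hᴴ H`. [folklore] -/
theorem wellBudget_le_card_pos {H : Matrix ι ι ℂ} (E : ℝ) {k : ℕ} (φ : Fin k → ι → ℂ)
    (hsupp : ∀ a b, a ≠ b → ∀ i, φ a i = 0 ∨ φ b i = 0)
    (hHorth : ∀ a b, a ≠ b → star (H *ᵥ φ a) ⬝ᵥ (H *ᵥ φ b) = 0)
    (hquasi : ∀ a, ∑ i, ‖(H *ᵥ φ a) i‖ ^ 2 < E ^ 2 * ∑ i, ‖φ a i‖ ^ 2)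
    (hA : (((E ^ 2 : ℝ) : ℂ) • (1 : Matrix ι ι ℂ) - Hᴴ * H).IsHermitian) :
    k ≤ (Finset.univ.filter fun i => 0 < hA.eigenvalues i).card := by
  -- disjoint supports ⇒ orthogonality
  have hφorth : ∀ a b, a ≠ b → star (φ a) ⬝ᵥ φ b = 0 := by
    intro a b hab
    rw [dotProduct]
    refine Finset.sum_eq_zero fun i _ => ?_
    rcases hsupp a b hab i with h | h <;> simp [h]
  -- the comparison map `c ↦ Σ cₐ φₐ`
  let Emap : (Fin k → ℂ) →ₗ[ℂ] (ι → ℂ) :=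
    { toFun := fun c => ∑ a, c a • φ a
      map_add' := fun c c' => by
        simp only [Pi.add_apply, add_smul, Finset.sum_add_distrib]
      map_smul' := fun r c => by
        simp only [Pi.smul_apply, smul_eq_mul, RingHom.id_apply, Finset.smul_sum, smul_smul] }
  have hEmap : ∀ c, Emap c = ∑ a, c a • φ a := fun c => rfl
  have key := card_le_card_eigenvalues_of_form_pos hA 1 Emap ?_
  · simpa using key
  intro c hc
  rw [one_mul, hEmap, sub_mulVec, dotProduct_sub, Complex.sub_re, smul_mulVec, one_mulVec,
    dotProduct_smul, smul_eq_mul, Complex.re_ofReal_mul, ← mulVec_mulVec, dotProduct_mulVec,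
    ← star_mulVec, mulVec_sum]
  simp_rw [mulVec_smul]
  rw [re_star_dotProduct_sum_smul_of_orthogonal φ c hφorth,
    re_star_dotProduct_sum_smul_of_orthogonal (fun a => H *ᵥ φ a) c hHorth, Finset.mul_sum,
    ← Finset.sum_sub_distrib]
  -- each summand is `‖cₐ‖² (E²‖φₐ‖² − ‖Hφₐ‖²) ≥ 0`, and one is `> 0`
  obtain ⟨a₀, ha₀⟩ : ∃ a, c a ≠ 0 := Function.ne_iff.mp hc
  refine Finset.sum_pos' (fun a _ => ?_) ⟨a₀, Finset.mem_univ _, ?_⟩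
  · have := hquasi a
    nlinarith [sq_nonneg ‖c a‖, norm_nonneg (c a)]
  · have h1 := hquasi a₀
    have h2 : 0 < ‖c a₀‖ ^ 2 := by positivity
    nlinarith

/-- **(A₁) Spectral mapping step (standard; left to the prover):** the positive eigenvalues of
`E² − Hᴴ H` are counted by the eigenvalues of the Hermitian `H` in `(−E, E)`, i.e. by the roots
of `charpoly H` with `|Re z| < E` (EXTINCT(b)'s currency). [folklore] -/
theorem card_pos_shiftSq_eq_countP {H : Matrix ι ι ℂ} (hH : H.IsHermitian) (E : ℝ) (hE : 0 < E)
    (hA : (((E ^ 2 : ℝ) : ℂ) • (1 : Matrix ι ι ℂ) - Hᴴ * H).IsHermitian) :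
    (Finset.univ.filter fun i => 0 < hA.eigenvalues i).card =
      H.charpoly.roots.countP (fun z => |z.re| < E) := by
  sorry

/-- **(A) Min-max well budget.** `k` nonzero vectors `φ a` with pairwise disjoint supports,
pairwise orthogonal images `H φ a ⊥ H φ b`, each a quasi-mode of the Hermitian `H` strictly below
level `E` (`‖H φ‖² < E² ‖φ‖²`), force `k ≤ #{eigenvalues of H in (−E, E)}` (counted with
multiplicity, as roots of the characteristic polynomial). For a range-one `H` on a torus,
"disjoint supports at mutual distance `≥ 3`" gives the `H`-orthogonality for free. -/
theorem wellBudget_le_windowCount {H : Matrix ι ι ℂ} (hH : H.IsHermitian) (E : ℝ) (hE : 0 < E)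
    {k : ℕ} (φ : Fin k → ι → ℂ)
    (hsupp : ∀ a b, a ≠ b → ∀ i, φ a i = 0 ∨ φ b i = 0)
    (hHorth : ∀ a b, a ≠ b → star (H *ᵥ φ a) ⬝ᵥ (H *ᵥ φ b) = 0)
    (hquasi : ∀ a, ∑ i, ‖(H *ᵥ φ a) i‖ ^ 2 < E ^ 2 * ∑ i, ‖φ a i‖ ^ 2) :
    k ≤ H.charpoly.roots.countP (fun z => |z.re| < E) := by
  have hA : (((E ^ 2 : ℝ) : ℂ) • (1 : Matrix ι ι ℂ) - Hᴴ * H).IsHermitian :=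
    (Matrix.isHermitian_one.smul (Complex.conj_ofReal _)).sub (Matrix.isHermitian_conjTranspose_mul_self H)
  rw [← card_pos_shiftSq_eq_countP hH E hE hA]
  exact wellBudget_le_card_pos E φ hsupp hHorth hquasi hA

/-- **(B) Operator Agmon estimate from an OUTER floor (eigen-equation trick, no `1/g` prefactor).**
`A` has off-site range one for the integer-valued pseudo-distance `dist`, off-diagonal row and
column sums `≤ h`; `ρ` is 1-Lipschitz for `dist` (think `ρ = dist(·, R)`, `R` the well set);
OUTER FLOOR: for every `|λ| ≤ E₀`, `‖(A − λ) v‖ ≥ g ‖v‖` whenever `v` vanishes on `{ρ < r₀}`.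
Then every eigenvector `A ψ = λ ψ` with `|λ| ≤ E₀` is exponentially small beyond `{ρ ≥ r₀ + d}`,
at any rate `κ ≥ 0` with `h (e^κ − 1) ≤ g/4`; the constant is absolute because `(A − λ)(χ w ψ) =
[A, χ w] ψ` for an eigenvector, so only gradients of the cutoff `χ` and of the weight `w = e^{κρ}`
appear. -/
theorem agmon_of_outer_floor (dist : ι → ι → ℕ) (hd0 : ∀ i, dist i i = 0)
    (hds : ∀ i j, dist i j = dist j i) (hdt : ∀ i j l, dist i l ≤ dist i j + dist j l)
    (A : Matrix ι ι ℂ) (hrange : ∀ i j, A i j ≠ 0 → dist i j ≤ 1) (h : ℝ)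
    (hrow : ∀ i, ∑ j ∈ univ.filter (fun j => dist i j ≠ 0), ‖A i j‖ ≤ h)
    (hcol : ∀ j, ∑ i ∈ univ.filter (fun i => dist i j ≠ 0), ‖A i j‖ ≤ h)
    (ρ : ι → ℕ) (hρ : ∀ i j, (ρ i : ℤ) - ρ j ≤ dist i j)
    (E₀ g : ℝ) (hg : 0 < g) (r₀ : ℕ)
    (hfloor : ∀ lam : ℝ, |lam| ≤ E₀ → ∀ v : ι → ℂ, (∀ i, ρ i < r₀ → v i = 0) →
      g ^ 2 * ∑ i, ‖v i‖ ^ 2 ≤ ∑ i, ‖((A - (lam : ℂ) • (1 : Matrix ι ι ℂ)) *ᵥ v) i‖ ^ 2)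
    (κ : ℝ) (hκ : 0 ≤ κ) (hκh : h * (Real.exp κ - 1) ≤ g / 4) :
    ∀ (lam : ℝ) (ψ : ι → ℂ), |lam| ≤ E₀ → A *ᵥ ψ = (lam : ℂ) • ψ →
      ∀ d : ℕ, ∑ i ∈ univ.filter (fun i => r₀ + d ≤ ρ i), ‖ψ i‖ ^ 2 ≤
        100 * Real.exp (-(2 * κ * (d : ℝ))) * ∑ i, ‖ψ i‖ ^ 2 := by
  sorry

end MatrixLemmas

section Wilson

variable {S : ℕ}

/-- **(C) Window modes of `Γ₅ D_W` live on a well set counted by the window itself (the stub the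
host line registers).** For every `SU(3)` field `U` on the four-torus of side `2S+1`, bare mass
`m₀`, window `w > 0` and `θ ∈ (0, 1/3)`: with `H = Γ₅ D_W(U, m₀, 1)` and `N` the number of its
eigenvalues in `(−w, w)`, there is a set `R` of at most `7⁴ (r+1)⁴ · N` sites,
`r = ⌈200/(√θ · w)⌉` (boxes of side `r` failing the local quasi-mode test at level `(1−θ)w`,
counted by (A); outer floor by IMS patching; decay by (B)), such that every eigenvector with
`|λ| ≤ (1 − 2θ) w` has at most `100 e^{−θ w d / 800}` of its `ℓ²` mass at taxi distance `≥ d` from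
`R`. In the crux: `m₀ = m_f(k)`, `w = c · a_k m_f / Z_k`, and `E₊[N] ≤ ε ((2S+1)/(2L_k+1))⁴` by
EXTINCT(b); so the window spectral subspace is pinned, configuration by configuration, to
`≤ C(θ) (Z_k/(√θ c a_k m_f))⁴ · N` sites, with tails of physical length `800 Z_k/(θ c m_f)`. -/
theorem windowModes_localised_on_wells (U : GaugeConfig 4 (2 * S + 1) SU3) (m₀ w θ : ℝ)
    (hw : 0 < w) (hθ : 0 < θ) (hθ' : θ < 1 / 3) :
    ∃ R : Finset (TorusSite 4 (2 * S + 1)),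
      (R.card : ℝ) ≤ 7 ^ 4 * ((⌈200 / (Real.sqrt θ * w)⌉₊ : ℝ) + 1) ^ 4 *
          ((hermitianWilsonDirac (fundamentalRep (Fin 3)) U m₀ 1).charpoly.roots.countP
            (fun z => |z.re| < w) : ℝ) ∧
      ∀ (lam : ℝ) (ψ : Idx (2 * S + 1) 3 → ℂ), |lam| ≤ (1 - 2 * θ) * w →
        hermitianWilsonDirac (fundamentalRep (Fin 3)) U m₀ 1 *ᵥ ψ = (lam : ℂ) • ψ →
        ∀ d : ℕ, ∑ p ∈ univ.filter (fun p : Idx (2 * S + 1) 3 => ∀ x ∈ R, d ≤ torusTaxiDist p.1 x),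
            ‖ψ p‖ ^ 2 ≤ 100 * Real.exp (-(θ * w / 800 * (d : ℝ))) * ∑ p, ‖ψ p‖ ^ 2 := by
  sorry

/-- **(C′) The bad-box test is LOCAL in the gauge field** (what makes joint rarity a statement about
local cylinder events): whether a box admits a quasi-mode below level `E` supported in it depends
only on the links with both ends in the box's 1-neighbourhood. Stated for two fields agreeing on
all links based within taxi distance `r + 1` of a site `x₀`. -/
theorem badBox_local (U V : GaugeConfig 4 (2 * S + 1) SU3) (m₀ E : ℝ) (x₀ : TorusSite 4 (2 * S + 1))
    (r : ℕ) (hUV : ∀ e : TorusSite 4 (2 * S + 1) × Fin 4, torusTaxiDist e.1 x₀ ≤ r + 1 → U e = V e) :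
    (∃ φ : Idx (2 * S + 1) 3 → ℂ, φ ≠ 0 ∧ (∀ p, r < torusTaxiDist p.1 x₀ → φ p = 0) ∧
        ∑ p, ‖(hermitianWilsonDirac (fundamentalRep (Fin 3)) U m₀ 1 *ᵥ φ) p‖ ^ 2 <
          E ^ 2 * ∑ p, ‖φ p‖ ^ 2) ↔
      (∃ φ : Idx (2 * S + 1) 3 → ℂ, φ ≠ 0 ∧ (∀ p, r < torusTaxiDist p.1 x₀ → φ p = 0) ∧
        ∑ p, ‖(hermitianWilsonDirac (fundamentalRep (Fin 3)) V m₀ 1 *ᵥ φ) p‖ ^ 2 <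
          E ^ 2 * ∑ p, ‖φ p‖ ^ 2) := by
  sorry

end Wilson

end Summit.QuantumFields.QCD.Cruxes.ExtinctionBuildsQCD.SparseWells

end
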